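import Summits.Schanuel.Schanuel.Theorems.ZilberEacCriticalFibresExistence
import HarnessLib

/-!
# The critical size with targets of degree `δ`: diagonal-ray solutions (existence)

Zilber's Exponential-Algebraic Closedness, case ladder (host summit Schanuel, cell `pub-schanuel`,
seat 2, gen 14).  THE FAMILY (`e, δ ≥ 1`; targets `A₀, A₁ ∈ ℂ[x₀, x₁]` of total degree `≤ δ` with
top parts `Tⱼ = (Aⱼ)_δ(1,1) = Σ_{|n|=δ} coeff_n(Aⱼ)`; fibre coefficient sequences `B₀, B₁ : ℕ → ℂ`,
`Fⱼ(u) = Σ_{i<e} B_{j,i}uⁱ`; `r₀ ∈ ℝ`, `r₁ = 1/e - r₀`, `c ∈ ℂ`):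

  `W = {x₂ = r₀x₀ + r₁x₁ + c,  y₀ = A₀(x₀,x₁) + y₂F₀(y₂),  y₁ = A₁(x₀,x₁) + y₂F₁(y₂)} ⊆ ℂ³ × ℂ³`.

Along the diagonal rays with drift `δ`, `x = (2πiepm + δ log m)(1,1) + ρ`, one has
`e^{xⱼ} = m^δ e^{ρⱼ}`, `Aⱼ(x) = m^δ Âⱼ(s, ℓ, ρ)` with the POLYNOMIAL
`Âⱼ(s, ℓ, ρ) = Σ_n coeff_n(Aⱼ) s^{δ-|n|} (C + δℓ + sρ₀)^{n₀}(C + δℓ + sρ₁)^{n₁}` (`C = 2πiep`,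
`s = 1/m`, `ℓ = log m/m`; the `s`-homogenisation of `Aⱼ`), `Âⱼ(0, 0, ρ) = C^δ Tⱼ =: Pⱼ`, and
`y₂ = m^{δ/e}e^{β}`, `y₂^{i+1}/m^δ = σ^{e-1-i}e^{(i+1)β}` (`σ = m^{-δ/e}`, `β = c + r·ρ`).  The
rescaled system `e^{ρⱼ} = Âⱼ(s, ℓ, ρ) + Σᵢ B_{j,i}σ^{e-1-i}e^{(i+1)β}` is ENTIRE in `(σ, s, ℓ; ρ)`; its
limit is the coupled system `e^{ρⱼ} = Pⱼ + bⱼe^{e(c + r·ρ)}` (`bⱼ = B_{j,e-1}`) with TWO constants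
`P₀, P₁`, whose Jacobian determinant is `e((1/e - r₀)P₁E₀ + r₀P₀E₁)`.
**`exists_solutions_criticalTargets`**: every non-degenerate base solution continues to honest
solutions of `e^{xⱼ} = Aⱼ(x) + y₂Fⱼ(y₂)`, `y₂ = e^{r·x + c}` (implicit function theorem).  The case
`δ = 1`, `Aⱼ = Xⱼ` is `exists_solutions_criticalFibres`.

HONEST FRAMING: an existence theorem for explicit members of an OPEN cell (`ECCell 3 2`);
NOT Schanuel's conjecture; EAC ⇏ SC.
-/

noncomputable section

open Complex MvPolynomial Filter Topology

set_option linter.dupNamespace false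

namespace Summit.Schanuel.Schanuel.Theorems

section Targets

/-- Monomials in the support of `A ∈ ℂ[x₀, x₁]` have degree `n₀ + n₁ ≤ totalDegree A`.
[folklore] -/
theorem add_le_totalDegree_of_mem_support {A : MvPolynomial (Fin 2) ℂ} {n : Fin 2 →₀ ℕ}
    (hn : n ∈ A.support) : n 0 + n 1 ≤ A.totalDegree := by
  have h := le_totalDegree hn
  have e : (n.sum fun _ e => e) = n 0 + n 1 := by
    rw [show (n.sum fun _ e => e) = n.degree from rfl, Finsupp.degree_eq_sum, Fin.sum_univ_two]
  omega

/-- The three small parameters `(σ, s, ℓ) = (m^{-δ/e}, 1/m, log m/m) → 0`. [folklore] -/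
theorem tendsto_rootInvPow_inv_logDiv (e δ : ℕ) (he : 1 ≤ e) (hδ : 1 ≤ δ) :
    Tendsto (fun m : ℕ => ((((Real.exp (-(δ * Real.log m / e)) : ℝ)) : ℂ), (((1 / (m : ℝ) : ℝ)) : ℂ),
      (((Real.log m / (m : ℝ) : ℝ)) : ℂ))) atTop (𝓝 ((0 : ℂ), (0 : ℂ), (0 : ℂ))) := by
  refine Tendsto.prodMk_nhds ?_ tendsto_inv_and_log_div
  have hepos : (0 : ℝ) < e := by exact_mod_cast he
  have hδpos : (0 : ℝ) < δ := by exact_mod_cast hδ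
  have h1 : Tendsto (fun m : ℕ => -(δ * Real.log m / e)) atTop atBot := by
    have h0 := (Real.tendsto_log_atTop.comp tendsto_natCast_atTop_atTop).const_mul_atTop hδpos
    have := h0.atTop_div_const hepos
    exact tendsto_neg_atTop_atBot.comp this
  have h2 := (continuous_ofReal.tendsto (0 : ℝ)).comp (Real.tendsto_exp_atBot.comp h1)
  rw [ofReal_zero] at h2
  exact h2

/-- **THEOREM (diagonal-ray solutions at critical size, targets of degree `δ`).**  See the module
docstring.  Data: `e, δ ≥ 1`; targets `Atar : Fin 2 → ℂ[x₀,x₁]` with `totalDegree ≤ δ`; fibre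
coefficients `B : Fin 2 → ℕ → ℂ`; `r₀, c`; `p ≠ 0`; the constants
`Pⱼ = (2πiep)^δ · Σ_{|n|=δ} coeff_n(Aⱼ)`; a base pair with
`e^{ρⱼ*} = Pⱼ + B_{j,e-1}e^{e(c + r₀ρ₀* + (1/e-r₀)ρ₁*)}` and
`(1/e - r₀)P₁e^{ρ₀*} + r₀P₀e^{ρ₁*} ≠ 0`. (new)
[cite: MantovaMasser2023, §1 p.5 (the open case dim π(V) = 2 in ℂ³×ℂˣ³)] -/
theorem exists_solutions_criticalTargets (e δ : ℕ) (he : 1 ≤ e) (hδ : 1 ≤ δ)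
    (Atar : Fin 2 → MvPolynomial (Fin 2) ℂ) (htot : ∀ j, (Atar j).totalDegree ≤ δ)
    (B : Fin 2 → ℕ → ℂ) (r₀ : ℝ) (c : ℂ) {p : ℤ} (hp : p ≠ 0) (P : Fin 2 → ℂ)
    (hP : ∀ j, P j = (2 * Real.pi * I * (e : ℂ) * p) ^ δ *
      ∑ n ∈ (Atar j).support, (if n 0 + n 1 = δ then coeff n (Atar j) else 0))
    {ρs : ℂ × ℂ}
    (h0 : exp ρs.1 = P 0 +
      B 0 (e - 1) * exp ((e : ℂ) * (c + (r₀ : ℂ) * ρs.1 + ((1 / (e : ℝ) - r₀ : ℝ) : ℂ) * ρs.2)))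
    (h1 : exp ρs.2 = P 1 +
      B 1 (e - 1) * exp ((e : ℂ) * (c + (r₀ : ℂ) * ρs.1 + ((1 / (e : ℝ) - r₀ : ℝ) : ℂ) * ρs.2)))
    (hdet : ((1 / (e : ℝ) - r₀ : ℝ) : ℂ) * P 1 * exp ρs.1 + (r₀ : ℂ) * P 0 * exp ρs.2 ≠ 0) :
    ∃ (x : ℕ → Fin 2 → ℂ) (ρ : ℕ → ℂ × ℂ), Tendsto ρ atTop (𝓝 ρs) ∧
      (∀ m, x m 0 = 2 * Real.pi * I * (e : ℂ) * p * m + δ * Real.log m + (ρ m).1) ∧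
      (∀ m, x m 1 = 2 * Real.pi * I * (e : ℂ) * p * m + δ * Real.log m + (ρ m).2) ∧
      (∀ᶠ m in atTop, ∀ j : Fin 2,
        exp (x m j) = eval (x m) (Atar j) +
          exp (∑ i, ((![r₀, 1 / (e : ℝ) - r₀] : Fin 2 → ℝ) i : ℂ) * x m i + c) *
          ∑ i ∈ Finset.range e, B j i *
            (exp (∑ i, ((![r₀, 1 / (e : ℝ) - r₀] : Fin 2 → ℝ) i : ℂ) * x m i + c)) ^ i) := by
  classical
  -- constants
  have he0 : e ≠ 0 := by omega
  have heC : (e : ℂ) ≠ 0 := by exact_mod_cast he0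
  have heR : (e : ℝ) ≠ 0 := by exact_mod_cast he0
  set C : ℂ := 2 * Real.pi * I * (e : ℂ) * p with hC
  set r₁ : ℂ := ((1 / (e : ℝ) - r₀ : ℝ) : ℂ) with hr₁
  have hC0 : C ≠ 0 := mul_ne_zero (mul_ne_zero Complex.two_pi_I_ne_zero heC) (by exact_mod_cast hp)
  have hsum : (e : ℂ) * ((r₀ : ℂ) + r₁) = 1 := by
    rw [hr₁]; push_cast; field_simp; ring
  have hdeg : ∀ j, ∀ n ∈ (Atar j).support, n 0 + n 1 ≤ δ :=
    fun j n hn => (add_le_totalDegree_of_mem_support hn).trans (htot j)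
  -- the homogenised targets `Âⱼ(s, ℓ, ρ)`
  set Ah : Fin 2 → ℂ → ℂ → ℂ × ℂ → ℂ := fun j s l ρ =>
    ∑ n ∈ (Atar j).support, coeff n (Atar j) * s ^ (δ - (n 0 + n 1)) *
      ((C + (δ : ℂ) * l + s * ρ.1) ^ (n 0) * (C + (δ : ℂ) * l + s * ρ.2) ^ (n 1)) with hAh
  have hAh0 : ∀ j ρ, Ah j 0 0 ρ = P j := by
    intro j ρ
    rw [hP j, hAh, Finset.mul_sum]
    refine Finset.sum_congr rfl fun n hn => ?_
    have hle := hdeg j n hn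
    by_cases hnd : n 0 + n 1 = δ
    · rw [if_pos hnd, show δ - (n 0 + n 1) = 0 by omega, pow_zero, mul_one,
        show C + (δ : ℂ) * 0 + 0 * ρ.1 = C by ring, show C + (δ : ℂ) * 0 + 0 * ρ.2 = C by ring,
        ← pow_add, hnd]
      ring
    · rw [if_neg hnd, zero_pow (by omega)]
      ring
  -- the rescaled system; `β(ρ) = c + r₀ρ₀ + r₁ρ₁`
  set f : (ℂ × ℂ × ℂ) × (ℂ × ℂ) → ℂ × ℂ := fun w =>
    (exp w.2.1 - Ah 0 w.1.2.1 w.1.2.2 w.2 - (∑ i ∈ Finset.range e, B 0 i * w.1.1 ^ (e - 1 - i) *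
        exp (((i : ℕ) + 1 : ℂ) * (c + (r₀ : ℂ) * w.2.1 + r₁ * w.2.2))),
      exp w.2.2 - Ah 1 w.1.2.1 w.1.2.2 w.2 - (∑ i ∈ Finset.range e, B 1 i * w.1.1 ^ (e - 1 - i) *
        exp (((i : ℕ) + 1 : ℂ) * (c + (r₀ : ℂ) * w.2.1 + r₁ * w.2.2))))
    with hf
  have hfC : ContDiff ℂ 1 f := by
    rw [hf, hAh]
    fun_prop
  set G₀ : ℂ := B 0 (e - 1) * exp ((e : ℂ) * (c + (r₀ : ℂ) * ρs.1 + r₁ * ρs.2)) with hG₀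
  set G₁ : ℂ := B 1 (e - 1) * exp ((e : ℂ) * (c + (r₀ : ℂ) * ρs.1 + r₁ * ρs.2)) with hG₁
  -- the fibre sums at `σ = 0` collapse to their top terms
  have hS0 : ∀ (j : Fin 2) (a b : ℂ), (∑ i ∈ Finset.range e, B j i * (0 : ℂ) ^ (e - 1 - i) *
      exp (((i : ℕ) + 1 : ℂ) * (c + (r₀ : ℂ) * a + r₁ * b))) =
      B j (e - 1) * exp ((e : ℂ) * (c + (r₀ : ℂ) * a + r₁ * b)) := by
    intro j a b
    rw [Finset.sum_eq_single (e - 1)]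
    · rw [Nat.sub_self, pow_zero, mul_one]
      congr 2
      push_cast [Nat.cast_sub he]
      ring
    · intro i hi hne
      have hlt : i < e - 1 := lt_of_le_of_ne (Nat.le_sub_one_of_lt (Finset.mem_range.1 hi)) hne
      rw [zero_pow (by omega), mul_zero, zero_mul]
    · intro h; exact absurd (Finset.mem_range.2 (by omega)) h
  have hfq : f (((0 : ℂ), (0 : ℂ), (0 : ℂ)), ρs) = 0 := by
    simp only [hf, Prod.mk_eq_zero, hS0, hAh0]
    constructor
    · rw [h0, hG₀]; ring
    · rw [h1, hG₁]; ring
  -- the partial derivative and its injectivity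
  set L : (ℂ × ℂ) →L[ℂ] (ℂ × ℂ) :=
    ((exp ρs.1 - (e : ℂ) * G₀ * r₀) • ContinuousLinearMap.fst ℂ ℂ ℂ -
        ((e : ℂ) * G₀ * r₁) • ContinuousLinearMap.snd ℂ ℂ ℂ).prod
      (-((e : ℂ) * G₁ * r₀) • ContinuousLinearMap.fst ℂ ℂ ℂ +
        (exp ρs.2 - (e : ℂ) * G₁ * r₁) • ContinuousLinearMap.snd ℂ ℂ ℂ) with hL
  have hLderiv : HasFDerivAt (fun q' : ℂ × ℂ => f (((0 : ℂ), (0 : ℂ), (0 : ℂ)), q')) L ρs := by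
    have eqf : (fun q' : ℂ × ℂ => f (((0 : ℂ), (0 : ℂ), (0 : ℂ)), q')) = fun q' =>
        (exp q'.1 - P 0 - B 0 (e - 1) * exp ((e : ℂ) * (c + (r₀ : ℂ) * q'.1 + r₁ * q'.2)),
          exp q'.2 - P 1 - B 1 (e - 1) * exp ((e : ℂ) * (c + (r₀ : ℂ) * q'.1 + r₁ * q'.2))) := by
      funext q'
      simp only [hf, hS0, hAh0]
    rw [eqf]
    have ha : HasFDerivAt (fun q' : ℂ × ℂ => q'.1) (ContinuousLinearMap.fst ℂ ℂ ℂ) ρs :=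
      hasFDerivAt_fst
    have hb : HasFDerivAt (fun q' : ℂ × ℂ => q'.2) (ContinuousLinearMap.snd ℂ ℂ ℂ) ρs :=
      hasFDerivAt_snd
    have hlin : HasFDerivAt (fun q' : ℂ × ℂ => (e : ℂ) * (c + (r₀ : ℂ) * q'.1 + r₁ * q'.2))
        ((e : ℂ) • ((r₀ : ℂ) • ContinuousLinearMap.fst ℂ ℂ ℂ + r₁ • ContinuousLinearMap.snd ℂ ℂ ℂ))
        ρs :=
      (((ha.const_mul (r₀ : ℂ)).const_add c).add (hb.const_mul r₁)).const_mul (e : ℂ)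
    have c0 := (ha.cexp.sub_const (P 0)).sub (hlin.cexp.const_mul (B 0 (e - 1)))
    have c1 := (hb.cexp.sub_const (P 1)).sub (hlin.cexp.const_mul (B 1 (e - 1)))
    refine (c0.prodMk c1).congr_fderiv ?_
    rw [hL, hG₀, hG₁]
    ext <;> simp <;> ring
  have hinj : Function.Injective L := by
    refine (injective_iff_map_eq_zero _).2 fun w hw => ?_
    have hw' : (exp ρs.1 - (e : ℂ) * G₀ * r₀) * w.1 - (e : ℂ) * G₀ * r₁ * w.2 = 0 ∧
        -((e : ℂ) * G₁ * r₀) * w.1 + (exp ρs.2 - (e : ℂ) * G₁ * r₁) * w.2 = 0 := by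
      rw [hL] at hw
      simpa [Prod.ext_iff] using hw
    obtain ⟨e0, e1⟩ := hw'
    have hE0 : G₀ = exp ρs.1 - P 0 := by rw [h0, hG₀]; ring
    have hE1 : G₁ = exp ρs.2 - P 1 := by rw [h1, hG₁]; ring
    rw [hE0] at e0
    rw [hE1] at e1
    -- Cramer: `det · w = 0` with `det = e(r₁P₁E₀ + r₀P₀E₁)`
    have hdet' : (e : ℂ) * (r₁ * P 1 * exp ρs.1 + (r₀ : ℂ) * P 0 * exp ρs.2) ≠ 0 :=
      mul_ne_zero heC hdet
    have hw1 : (e : ℂ) * (r₁ * P 1 * exp ρs.1 + (r₀ : ℂ) * P 0 * exp ρs.2) * w.1 = 0 := by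
      linear_combination (exp ρs.2 - (e : ℂ) * (exp ρs.2 - P 1) * r₁) * e0 +
        ((e : ℂ) * (exp ρs.1 - P 0) * r₁) * e1 + (exp ρs.1 * exp ρs.2 * w.1) * hsum
    have hw2 : (e : ℂ) * (r₁ * P 1 * exp ρs.1 + (r₀ : ℂ) * P 0 * exp ρs.2) * w.2 = 0 := by
      linear_combination ((e : ℂ) * (exp ρs.2 - P 1) * r₀) * e0 +
        (exp ρs.1 - (e : ℂ) * (exp ρs.1 - P 0) * r₀) * e1 + (exp ρs.1 * exp ρs.2 * w.2) * hsum
    have hw1' : w.1 = 0 := (mul_eq_zero.1 hw1).resolve_left hdet'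
    have hw2' : w.2 = 0 := (mul_eq_zero.1 hw2).resolve_left hdet'
    exact Prod.ext hw1' hw2'
  -- the implicit function and the solutions
  obtain ⟨ψ, hψsol, hψlim⟩ := exists_implicit_of_injective_partial hfC hfq hLderiv hinj
  set pr : ℕ → ℂ × ℂ × ℂ := fun m => ((((Real.exp (-(δ * Real.log m / e)) : ℝ)) : ℂ),
    (((1 / (m : ℝ) : ℝ)) : ℂ), (((Real.log m / (m : ℝ) : ℝ)) : ℂ)) with hpr
  have hprt : Tendsto pr atTop (𝓝 ((0 : ℂ), (0 : ℂ), (0 : ℂ))) :=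
    tendsto_rootInvPow_inv_logDiv e δ he hδ
  have hρlim : Tendsto (fun m => ψ (pr m)) atTop (𝓝 ρs) := hψlim.comp hprt
  have hsol : ∀ᶠ m in atTop, f (pr m, ψ (pr m)) = 0 := hprt.eventually hψsol
  set x : ℕ → Fin 2 → ℂ := fun m =>
    ![C * m + δ * Real.log m + (ψ (pr m)).1, C * m + δ * Real.log m + (ψ (pr m)).2] with hx
  refine ⟨x, fun m => ψ (pr m), hρlim,
    fun m => by simp only [hx, Matrix.cons_val_zero, hC],
    fun m => by simp only [hx, Matrix.cons_val_one, Matrix.cons_val_zero, hC], ?_⟩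
  filter_upwards [hsol, eventually_ge_atTop 1] with m hm hm1
  have hmpos : (0 : ℝ) < (m : ℝ) := by exact_mod_cast hm1
  have hmC : (m : ℂ) ≠ 0 := by exact_mod_cast (show m ≠ 0 by omega)
  set σ : ℂ := ((Real.exp (-(δ * Real.log m / e)) : ℝ) : ℂ) with hσ
  have hσexp : σ = exp (-((δ : ℂ) * ((Real.log m : ℝ) : ℂ) / (e : ℂ))) := by
    rw [hσ, Complex.ofReal_exp]
    congr 1
    push_cast
    ring
  have hexpL : exp ((Real.log m : ℝ) : ℂ) = (m : ℂ) := by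
    rw [← Complex.ofReal_exp, Real.exp_log hmpos]; push_cast; rfl
  have hexpLδ : exp ((δ : ℂ) * ((Real.log m : ℝ) : ℂ)) = (m : ℂ) ^ δ := by
    rw [Complex.exp_nat_mul, hexpL]
  have hexpP : exp (C * m) = 1 := by
    have := Complex.exp_int_mul_two_pi_mul_I ((e : ℤ) * p * m)
    rw [← this, hC]; congr 1; push_cast; ring
  have hexpP' : exp (2 * Real.pi * I * (p : ℂ) * m) = 1 := by
    have := Complex.exp_int_mul_two_pi_mul_I (p * m)
    rw [← this]; congr 1; push_cast; ring
  have hmδ : (m : ℂ) ^ δ ≠ 0 := pow_ne_zero _ hmC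
  have hs : (((1 / (m : ℝ) : ℝ)) : ℂ) = 1 / (m : ℂ) := by push_cast; rfl
  have hl : (((Real.log m / (m : ℝ) : ℝ)) : ℂ) = ((Real.log m : ℝ) : ℂ) * (1 / (m : ℂ)) := by
    rw [Complex.ofReal_div]; push_cast; ring
  -- `β(m)`, the rescaled sums, and the identities
  set β : ℂ := c + (r₀ : ℂ) * (ψ (pr m)).1 + r₁ * (ψ (pr m)).2 with hβ
  set S : Fin 2 → ℂ := fun j => ∑ i ∈ Finset.range e, B j i * σ ^ (e - 1 - i) *
    exp (((i : ℕ) + 1 : ℂ) * β) with hS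
  have heq : exp (ψ (pr m)).1 = Ah 0 (1 / (m : ℂ)) (((Real.log m : ℝ) : ℂ) * (1 / (m : ℂ))) (ψ (pr m)) + S 0 ∧
      exp (ψ (pr m)).2 = Ah 1 (1 / (m : ℂ)) (((Real.log m : ℝ) : ℂ) * (1 / (m : ℂ))) (ψ (pr m)) + S 1 := by
    have hpr1 : (pr m).1 = σ := by simp only [hpr]; rfl
    have hpr2 : (pr m).2.1 = 1 / (m : ℂ) := by simp only [hpr]; exact hs
    have hpr3 : (pr m).2.2 = ((Real.log m : ℝ) : ℂ) * (1 / (m : ℂ)) := by simp only [hpr]; exact hl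
    have hm' := hm
    simp only [hf, Prod.mk_eq_zero] at hm'
    rw [hpr1, hpr2, hpr3] at hm'
    obtain ⟨hm0, hm1'⟩ := hm'
    exact ⟨by rw [hS, hβ]; linear_combination hm0, by rw [hS, hβ]; linear_combination hm1'⟩
  obtain ⟨hq0, hq1⟩ := heq
  -- the targets: `m^δ Âⱼ(1/m, log m/m, ρ) = Aⱼ(x)`
  have hxj : ∀ j : Fin 2, C + (δ : ℂ) * (((Real.log m : ℝ) : ℂ) * (1 / (m : ℂ))) +
      1 / (m : ℂ) * (if j = 0 then (ψ (pr m)).1 else (ψ (pr m)).2) = x m j / (m : ℂ) := by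
    intro j
    fin_cases j
    · simp only [hx, Fin.zero_eta, Matrix.cons_val_zero, if_true]
      field_simp
    · simp only [hx, Fin.mk_one, Matrix.cons_val_one, Matrix.cons_val_zero,
        show ((1 : Fin 2) = 0) = False by decide, if_false]
      field_simp
  have hAeval : ∀ j : Fin 2, (m : ℂ) ^ δ *
      Ah j (1 / (m : ℂ)) (((Real.log m : ℝ) : ℂ) * (1 / (m : ℂ))) (ψ (pr m)) = eval (x m) (Atar j) := by
    intro j
    rw [hAh, eval_eq', Finset.mul_sum]
    refine Finset.sum_congr rfl fun n hn => ?_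
    have hle := hdeg j n hn
    have e0 := hxj 0
    have e1 := hxj 1
    simp only [if_true] at e0
    simp only [show ((1 : Fin 2) = 0) = False by decide, if_false] at e1
    rw [Fin.prod_univ_two, e0, e1]
    have hmsplit : (m : ℂ) ^ δ = (m : ℂ) ^ (δ - (n 0 + n 1)) * ((m : ℂ) ^ (n 0) * (m : ℂ) ^ (n 1)) := by
      rw [← pow_add, ← pow_add, Nat.sub_add_cancel hle]
    have key : (m : ℂ) ^ δ * ((1 / (m : ℂ)) ^ (δ - (n 0 + n 1)) *
        ((x m 0 / (m : ℂ)) ^ (n 0) * (x m 1 / (m : ℂ)) ^ (n 1))) = x m 0 ^ (n 0) * x m 1 ^ (n 1) := by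
      rw [one_div_pow, div_pow, div_pow, hmsplit]
      have h1 : (m : ℂ) ^ (δ - (n 0 + n 1)) ≠ 0 := pow_ne_zero _ hmC
      have h2 : (m : ℂ) ^ (n 0) ≠ 0 := pow_ne_zero _ hmC
      have h3 : (m : ℂ) ^ (n 1) ≠ 0 := pow_ne_zero _ hmC
      field_simp
    calc (m : ℂ) ^ δ * (coeff n (Atar j) * (1 / (m : ℂ)) ^ (δ - (n 0 + n 1)) *
          ((x m 0 / (m : ℂ)) ^ (n 0) * (x m 1 / (m : ℂ)) ^ (n 1)))
        = coeff n (Atar j) * ((m : ℂ) ^ δ * ((1 / (m : ℂ)) ^ (δ - (n 0 + n 1)) *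
          ((x m 0 / (m : ℂ)) ^ (n 0) * (x m 1 / (m : ℂ)) ^ (n 1)))) := by ring
      _ = coeff n (Atar j) * (x m 0 ^ (n 0) * x m 1 ^ (n 1)) := by rw [key]
  -- the hyperplane value along the solution
  have hlin : (∑ i, ((![r₀, 1 / (e : ℝ) - r₀] : Fin 2 → ℝ) i : ℂ) * x m i) + c =
      2 * Real.pi * I * (p : ℂ) * m + (δ : ℂ) * ((Real.log m : ℝ) : ℂ) / (e : ℂ) + β := by
    rw [Fin.sum_univ_two]
    simp only [hx, hβ, hr₁, hC, Matrix.cons_val_zero, Matrix.cons_val_one]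
    push_cast
    field_simp
    ring
  -- `y₂^{i+1} = m^δ σ^{e-1-i} e^{(i+1)β}`
  have hy : exp (2 * Real.pi * I * (p : ℂ) * m + (δ : ℂ) * ((Real.log m : ℝ) : ℂ) / (e : ℂ) + β) =
      exp ((δ : ℂ) * ((Real.log m : ℝ) : ℂ) / (e : ℂ)) * exp β := by
    rw [Complex.exp_add, Complex.exp_add, hexpP', one_mul]
  have hpowi : ∀ i ∈ Finset.range e, (exp ((δ : ℂ) * ((Real.log m : ℝ) : ℂ) / (e : ℂ)) * exp β) *
      (exp ((δ : ℂ) * ((Real.log m : ℝ) : ℂ) / (e : ℂ)) * exp β) ^ i =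
      (m : ℂ) ^ δ * (σ ^ (e - 1 - i) * exp (((i : ℕ) + 1 : ℂ) * β)) := by
    intro i hi
    have hie : i < e := Finset.mem_range.1 hi
    have hcast : (((e - 1 - i : ℕ)) : ℂ) = (e : ℂ) - 1 - i := by
      rw [Nat.cast_sub (by omega), Nat.cast_sub he]; push_cast; ring
    rw [← pow_succ', ← Complex.exp_add, ← Complex.exp_nat_mul, hσexp, ← Complex.exp_nat_mul,
      ← hexpLδ, ← Complex.exp_add, ← Complex.exp_add]
    congr 1
    rw [hcast]
    push_cast
    field_simp
    ring
  have hSsum : ∀ j : Fin 2, exp (2 * Real.pi * I * (p : ℂ) * m + (δ : ℂ) * ((Real.log m : ℝ) : ℂ) / (e : ℂ) + β) *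
      ∑ i ∈ Finset.range e, B j i *
        (exp (2 * Real.pi * I * (p : ℂ) * m + (δ : ℂ) * ((Real.log m : ℝ) : ℂ) / (e : ℂ) + β)) ^ i =
      (m : ℂ) ^ δ * S j := by
    intro j
    rw [hy, hS, Finset.mul_sum, Finset.mul_sum]
    refine Finset.sum_congr rfl fun i hi => ?_
    rw [show exp ((δ : ℂ) * ((Real.log m : ℝ) : ℂ) / (e : ℂ)) * exp β *
        (B j i * (exp ((δ : ℂ) * ((Real.log m : ℝ) : ℂ) / (e : ℂ)) * exp β) ^ i) =
      B j i * ((exp ((δ : ℂ) * ((Real.log m : ℝ) : ℂ) / (e : ℂ)) * exp β) *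
        (exp ((δ : ℂ) * ((Real.log m : ℝ) : ℂ) / (e : ℂ)) * exp β) ^ i) by ring, hpowi i hi]
    ring
  have hx0exp : exp (C * m + (δ : ℂ) * ((Real.log m : ℝ) : ℂ) + (ψ (pr m)).1) =
      (m : ℂ) ^ δ * exp (ψ (pr m)).1 := by
    rw [Complex.exp_add, Complex.exp_add, hexpP, one_mul, hexpLδ]
  have hx1exp : exp (C * m + (δ : ℂ) * ((Real.log m : ℝ) : ℂ) + (ψ (pr m)).2) =
      (m : ℂ) ^ δ * exp (ψ (pr m)).2 := by
    rw [Complex.exp_add, Complex.exp_add, hexpP, one_mul, hexpLδ]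
  intro j
  rw [hlin, hSsum j, ← hAeval j]
  fin_cases j
  · simp only [hx, Fin.zero_eta, Matrix.cons_val_zero]
    rw [hx0exp, hq0]
    ring
  · simp only [hx, Fin.mk_one, Matrix.cons_val_one, Matrix.cons_val_zero]
    rw [hx1exp, hq1]
    ring

end Targets

end Summit.Schanuel.Schanuel.Theorems

end
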